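import Summits.QuantumFields.QCD.Theses.HeatSlicedQuarks
import Summits.QuantumFields.QCD.Theorems.NestedDissectionSeaThresholdShift
import Literature.MathematicalPhysics.QuantumFieldTheory.QuasiLocalGaugePerturbation
import Summits.QuantumFields.YangMills.Statement
import Literature.MathematicalPhysics.QuantumFieldTheory.QCDTimeReflection

/-!
# Sketch — crux idea `offset-last-format-handover` (crux stmt-QuantumFields-18031 `InterleavedFlowProper`)

First lemmas of the line, over existing declarations (planner sketch; the idea card cites these names).

* `ThresholdContinuumQCDExists` / `continuumQCDExists_iff_threshold` — X₀ is OFFSET-BLIND: the route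
  target `ContinuumQCDExists` (no `IsChiralAtZero`, no gap clause) is equivalent to its heavy-threshold
  form `∃ M₀ ≥ 0, … ∀ m, (∀ f, M₀ < m f) → …` (proved here from the tree's `thresholdShift_generic`).
  This is the legal basis of the lever "choose the flavour-blind RGI offset M₀ LAST".
* `OffsetMeetsThreshold` — the quantifier match with `HeavyThresholdYMBridge.RobustYangMillsRG`
  (stmt-QuantumFields-14958: `∀ format constants, ∃ β₀, ∀ data, ∀ ℓ₀, ∀ w βe, βe ≥ β₀ → package`): for every
  block-coupling threshold `β₀` there is an offset `M₀` such that the two-loop inverse coupling at EVERY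
  fermion-active block scale `ℓ ≤ 1/M₀` exceeds `β₀` (stated; real analysis on `afBeta`, provable now).
* `HeavyTailSliceBound` — the "massive last slice" of the heat-slice engine is U-UNIFORM: for a positive
  (renormalised, block-unit) mass the proper-time tail `t ≥ T` of the quark covariance is bounded by
  `e^{−T m²}/m… `-type accretivity, here in the entrywise form the engine uses (stated over `NormedSpace.exp`).
-/

namespace Summit.QuantumFields.QCD.Cruxes.InterleavedFlowProper.OffsetLastFormatHandover

open Summit.QuantumFields.QCD.Theses.HeatSlicedQuarks
open Literature.MathematicalPhysics.QuantumFieldTheory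
open Filter Topology MeasureTheory

/-- Heavy-threshold form of the route target X₀ = `ContinuumQCDExists`: the flavour-blind RGI offset `M₀`
is made explicit. -/
def ThresholdContinuumQCDExists : Prop :=
  ∀ Nf : ℕ, Nf = 2 ∨ Nf = 3 → ∃ M₀ : ℝ, 0 ≤ M₀ ∧ ∃ reg : QCDRegularisation Nf, reg.HasMassScaling ∧
    ∀ m : Fin Nf → ℝ, (∀ f, M₀ < m f) →
      ∃ (z shift : QCDField Nf → ℕ → ℝ) (T : OSData (QCDField Nf) 4),
        IsQCDAlong (reg.scheme m z shift) T ∧ T.IsNontrivial QCDField.glue ∧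
          T.IsNonGaussian QCDField.glue ∧ ∀ f g : Fin Nf, f ≠ g → T.IsNontrivial (QCDField.pseudoRe f g)

/-- **First lemma (legal basis of the lever): X₀ is offset-blind.** `ContinuumQCDExists` carries no
chirality pin and no gap clause, so re-basing `m_crit(k) ↦ m_crit(k) + a_k M₀ / Z_m(k)` (tree
`thresholdShift_generic`) absorbs any threshold `M₀ ≥ 0`: the offset may be chosen LAST, after every
constant of the construction. -/
theorem continuumQCDExists_iff_threshold : ContinuumQCDExists ↔ ThresholdContinuumQCDExists := by
  constructor
  · intro h Nf hNf
    obtain ⟨reg, hms, hall⟩ := h Nf hNf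
    exact ⟨0, le_rfl, reg, hms, fun m hm => hall m hm⟩
  · intro h Nf hNf
    obtain ⟨M₀, hM₀, reg, hms, hall⟩ := h Nf hNf
    obtain ⟨reg', hms', hsch⟩ := Summit.QuantumFields.QCD.Theorems.thresholdShift_generic Nf reg M₀
    refine ⟨reg', hms' hms, fun m hm => ?_⟩
    obtain ⟨z, shift, T, hT⟩ := hall (fun f => m f + M₀) (fun f => by linarith [hm f])
    exact ⟨z, shift, T, by rw [hsch]; exact hT⟩

/-- **Offset-last meets any block-coupling threshold** (quantifier match with item 14958): for `N_f ∈ {2,3}`,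
every lattice Λ-parameter and every threshold `β₀` there is an offset `M₀ > 0` such that the two-loop
inverse bare/block coupling `afBeta N_f Λ ℓ` exceeds `β₀` at every block scale `0 < ℓ ≤ 1/M₀` — every
fermion-active scale of the heavy-offset flow is as weakly coupled as the consumer demands. -/
def OffsetMeetsThreshold : Prop :=
  ∀ Nf : ℕ, Nf = 2 ∨ Nf = 3 → ∀ Λ : ℝ, 0 < Λ → ∀ β₀ : ℝ, ∃ M₀ : ℝ, 0 < M₀ ∧
    ∀ ℓ : ℝ, 0 < ℓ → ℓ ≤ 1 / M₀ → β₀ ≤ afBeta Nf Λ ℓ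

/-- **Massive last slice, U-uniform** (the handover step of the heat-slice engine at the quark scale):
for every SU(3) field `U`, every POSITIVE mass `m` (the renormalised mass in block units at the handover
scale) and all `0 ≤ T ≤ t`, every colour–spin entry of `e^{−t H_U}`, `H_U = D_W(U,m,1)ᴴ D_W(U,m,1)`, is at
most `e^{−(t−T) m²}` times the operator norm bound `1` — accretivity `Re D_W ≥ m` (tree
`AccretiveWilsonDirac`, proved) gives `H_U ≥ m²`, uniformly in the not-yet-integrated infrared gauge
field. Entrywise contraction form. -/
def HeavyTailSliceBound : Prop :=
  ∀ (L : ℕ) [NeZero L] (U : GaugeConfig 4 L (Matrix.specialUnitaryGroup (Fin 3) ℂ)) (m : ℝ), 0 < m →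
    ∀ (t : ℝ), 0 ≤ t → ∀ (x y : Literature.Probability.LatticeModels.TorusSite 4 L) (a b : Fin 3) (α β : Fin 4),
      ‖(NormedSpace.exp (-(t : ℂ) • (Matrix.conjTranspose
          (Literature.MathematicalPhysics.QuantumLattice.wilsonDirac
            (Literature.MathematicalPhysics.QuantumLattice.fundamentalRep (Fin 3)) U m 1) *
          Literature.MathematicalPhysics.QuantumLattice.wilsonDirac
            (Literature.MathematicalPhysics.QuantumLattice.fundamentalRep (Fin 3)) U m 1))) (x, a, α) (y, b, β)‖
        ≤ Real.exp (-(t * m ^ 2))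

/-- **The typed MILESTONE of the line (main stub): the heavy-offset QCD weight is in Bałaban format.**
`AdmAt` below is the `let AdmAt` binder of `HeavyThresholdYMBridge.RobustYangMillsRG`
(stmt-QuantumFields-14958) copied VERBATIM; the weight `w` is the time-antiperiodic quark-integrated
Wilson weight of `N_f` flavours at bare masses `m_crit(k) + a_k (M₀ + m_f)/Z_m(k)` (offset `M₀` chosen
AFTER the consumer's threshold `β₀`), and `βe` the block coupling at block scale `ℓ₀`, required convergent
and eventually `≥ β₀`. Quantifier order = the lever: format constants → `β₀` → `M₀, ℓ₀, reg` → mass tuple. -/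
def HeatSliceFormatMembership : Prop :=
  open Literature.MathematicalPhysics.QuantumLattice Literature.MathematicalPhysics.AQFT
    Literature.MathematicalPhysics.QuantumFieldTheory in
  let G := ↥(Matrix.specialUnitaryGroup (Fin 3) ℂ)
  let ρ : G →* Matrix (Fin 3) (Fin 3) ℂ := fundamentalRep (Fin 3)
  ∀ Nf : ℕ, Nf = 2 ∨ Nf = 3 →
    ∃ ε r B₀ κ c₀ : ℝ, 0 < ε ∧ 0 < r ∧ 0 < B₀ ∧ 0 < κ ∧ 0 < c₀ ∧
    ∀ β₀ : ℝ, ∃ M₀ ℓ₀ : ℝ, 0 < M₀ ∧ 0 < ℓ₀ ∧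
    ∃ reg : QCDRegularisation Nf, reg.HasMassScaling ∧ (reg.scheme 0 0 0).HasAsymptoticScaling ∧
    ∀ mr : Fin Nf → ℝ, (∀ f, 0 < mr f) →
    ∃ βe : ℕ → ℝ, (∃ βl, Tendsto βe atTop (nhds βl)) ∧
    let a : ℕ → ℝ := reg.a
    let b : ℕ → ℕ := fun k => ⌊ℓ₀ / a k⌋₊
    let N : ℕ → ℕ := fun S => 2 * S + 1
    let M : ℕ → ℕ → ℕ := fun k S => N S / b k - 1 + 1
    let cor : (k S : ℕ) → Site 4 (M k S) → Site 4 (N S) :=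
      fun k S y i => ((N S * (y i).val / M k S : ℕ) : ZMod (N S))
    let μ : (n : ℕ) → [NeZero n] → Measure (GaugeConfig 4 n G) :=
      fun _ _ => Measure.pi fun _ => haarProbability G
    let LF : (k S : ℕ) → GaugeConfig 4 (M k S) G → Finset (Site 4 (M k S)) :=
      fun _ _ V => Finset.univ.filter fun y => ∃ i j : Fin 4, ε < 3 - (ρ (plaquetteHolonomy V y i j)).trace.re
    let AdmAt : ((k S : ℕ) → GaugeConfig 4 (N S) G → ℝ) → (ℕ → ℝ) → ℕ → ℕ → Prop := fun w βe k S =>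
      Measurable (w k S) ∧ (0 < ∫ U, w k S U ∂(μ (N S))) ∧
      (∀ v U, w k S (torusConfigShift v U) = w k S U) ∧
      (∀ U, w k S (GaugeConfig.timeReflect U) = w k S U) ∧
      (∀ (π : Equiv.Perm (Fin 4)) U, w k S (U ∘ fun e => (e.1 ∘ π, π.symm e.2)) = w k S U) ∧
      (∀ F : GaugeConfig 4 (N S) G → ℝ, Measurable F → (∃ C, ∀ U, |F U| ≤ C) →
        IsPositiveTimeObservable F → 0 ≤ ∫ U, F U.timeReflect * F U * w k S U ∂(μ (N S))) ∧
      ∃ (Bl : GaugeConfig 4 (N S) G → GaugeConfig 4 (M k S) G)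
        (W : QuasiLocalGaugePerturbation 4 (M k S) G 1)
        (F : Finset (Site 4 (M k S)) → GaugeConfig 4 (M k S) G → ℝ),
        Measurable Bl ∧ (∀ g U, Bl (gaugeTransform g U) = gaugeTransform (g ∘ cor k S) (Bl U)) ∧
        (∀ e, DependsOn (fun U => Bl U e)
          {e' | ∀ i, (e'.1 i - cor k S e.1 i).val ≤ 5 * b k ∨ (cor k S e.1 i - e'.1 i).val ≤ 5 * b k}) ∧
        W.HasAnalyticNormLE ρ (smallFieldDomain ρ 1 r ε) κ B₀ ∧ W.NormLE κ B₀ ∧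
        (∀ X ∈ polymers 1, (∃ V, W.act X V ≠ 0) →
          ∀ y ∈ X, ∀ y' ∈ X, ∀ i, (y i - y' i).val ≤ X.card ∨ (y' i - y i).val ≤ X.card) ∧
        (∀ Z, Measurable (F Z)) ∧ (∀ V, F ∅ V = 1) ∧ (∀ Z V, |F Z V| ≤ Real.exp (c₀ * Z.card)) ∧
        (∀ Z (n : ℕ) V V', (∀ e, (∃ y ∈ Z, ∀ i, (e.1 i - y i).val ≤ n ∨ (y i - e.1 i).val ≤ n) → V e = V' e) →
          |F Z V - F Z V'| ≤ Real.exp (c₀ * Z.card + κ * (4 - n))) ∧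
        (∀ Z₁ Z₂ (n : ℕ), (∀ y ∈ Z₁, ∀ y' ∈ Z₂, ∃ i, n < (y i - y' i).val ∧ n < (y' i - y i).val) →
          ∀ V, |F (Z₁ ∪ Z₂) V - F Z₁ V * F Z₂ V| ≤ Real.exp (c₀ * (Z₁.card + Z₂.card) + κ * (4 - n))) ∧
        ∀ Gf, Measurable Gf → (∃ C, ∀ V, |Gf V| ≤ C) →
          ∫ U, Gf (Bl U) * w k S U ∂(μ (N S)) =
            ∫ V, Gf V * (Real.exp (-(βe k * (⨅ U : {U // Bl U = V}, wilsonAction ρ U.1)) - W.total V) *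
              F (LF k S V) V) ∂(μ (M k S))
    let w : (k S : ℕ) → GaugeConfig 4 (N S) G → ℝ := fun k _ U =>
      Real.exp (-(reg.β k * wilsonAction ρ U)) *
        (fermiIntegral (fermiBoltzmannAP U
          (fun f : Fin Nf => reg.mcrit k + reg.a k * (M₀ + mr f) / reg.Zm k))).re
    ∀ᶠ k in atTop, β₀ ≤ βe k ∧ ∀ S, reg.L k ≤ S → AdmAt w βe k S

/- The YM-side hypothesis item of the transfer is `Summit.QuantumFields.QCD.Theses.HeavyThresholdYMBridge.RobustYangMillsRG`
   (stmt-QuantumFields-14958); not imported here to keep this workfile independent of that route file's rebuilds. -/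

/-- Sanity: the threshold form at `M₀ = 0` is literally implied by X₀ (one direction, term-mode). -/
example (h : ContinuumQCDExists) : ThresholdContinuumQCDExists :=
  continuumQCDExists_iff_threshold.mp h

end Summit.QuantumFields.QCD.Cruxes.InterleavedFlowProper.OffsetLastFormatHandover
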